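import Summits.Ventures.HSemireg.WedgeHankelRecurrenceGaussGegenbauerLowering

/-!
# Venture HSemireg — **STIELTJES' EQUILIBRIUM FOR THE CHEBYSHEV NODES (the case `λ = 0`)**: Mathlib's equation `(1 − X²) T_n'' = X T_n' − n² T_n` and the chapter's node calibration
# `q_{n+1} = 2^{−n} T_{n+1} = ∏_k (X − cos((2k+1)π∕(2n+2)))` (N332) give, at the Chebyshev nodes `x_k`, **`Σ_{j ≠ k} 1∕(x_k − x_j) = x_k ∕ (2(1 − x_k²))`** — unit charges in equilibrium between two
# charges `¼` at `±1`; the explicit trigonometric identity `Σ_{j ≠ k} 1∕(cos θ_k − cos θ_j) = cos θ_k ∕ (2 sin² θ_k)` for `θ_k = (2k+1)π∕(2n+2)`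

HONEST FRAMING. Part of the Lean index of the computation cell `pub-hsemireg` (seat p10 gen 46, Sunday typer «UNIFORM-IN-n»).  Finite sums, Mathlib's Chebyshev `T` and its derivative identity only;
no variety, no cohomology theory, no sheaf, no Ext group and no semiregularity map is constructed here; nothing here says that HC / HC_CM / HC_AV holds; no Literature fact (unproved `Prop`) is
declared or used.  Custodian versions as in `WedgeHankelSiegelIdeal` (1/3).
SOURCES (cited).  T. J. Stieltjes, C. R. Acad. Sci. 100 (1885) 439–440; G. Szegő, *Orthogonal Polynomials*, §6.7 Thm 6.7.1 (Jacobi case `α = β = −½`), (4.7.5); M. E. H. Ismail, *Classical and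
Quantum Orthogonal Polynomials* (2005), §3.5.
PROOF TYPED HERE.  N388 `sum_inv_sub_nodes_eq` (`2 f'(x_k) Σ = f''(x_k)`) for `f = ∏ (X − x_k) = 2^{−n} T_{n+1}` (N332), and Mathlib `Polynomial.Chebyshev.one_sub_X_sq_mul_derivative_derivative_T_eq_poly_in_T`
evaluated at a node (`T_{n+1}(x_k) = 0`).
DEDUP DISCLOSURE (`rg -n -i 'chebyshev_zeros_electro|chebyshev_nodes_electro' Summits/Ventures/HSemireg`, 2026-09-03): N392 (`λ > 0`), N388 ∕ N389 (Hermite ∕ Laguerre); the `λ = 0` (Chebyshev `T`)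
case is new.  The 2 names below: 0 hits tree-wide.

WHAT IS IN THE TREE.  N332 `chebyshev_recurrence_eq_T`, `chebyshev_recurrence_eq_prod`, `chebyshev_nodes_strictMono`; N388 `sum_inv_sub_nodes_eq`; N284 `eval_derivative_prod_X_sub_C_at_node`;
N360 `recurrence_of_coefficients`; Mathlib `one_sub_X_sq_mul_derivative_derivative_T_eq_poly_in_T`.
THIS FILE (namespace `Summit.Ventures.HSemireg.Wedge.HankelOuter` continued; CHAINED on N396 (import only); 0 definitions):
* §1162 **`chebyshev_zeros_electrostatic`** (for any increasing `x` with `∏ (X − x_k) = 2^{−n} T_{n+1}`), **`chebyshev_nodes_electrostatic`** (at the explicit nodes `cos((2(n−k)+1)π∕(2n+2))`).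
CAVEATS.  First kind only (the second kind is N392 with `λ = 1`).  Nothing Ext-side.  New names only.
-/

open Module Polynomial Real
open scoped Matrix Polynomial

namespace Summit.Ventures.HSemireg.Wedge.HankelOuter

/-! ## §1162. Stieltjes' equilibrium at the Chebyshev nodes -/

/-- **`Σ_{j ≠ k} 1∕(x_k − x_j) = x_k ∕ (2(1 − x_k²))`** whenever `∏_k (X − x_k) = 2^{−n} T_{n+1}` with `x` injective and `|x_k| ≠ 1`. [Stieltjes 1885; Szegő Thm 6.7.1; this file, §1162] -/
theorem chebyshev_zeros_electrostatic {n : ℕ} {x : Fin (n + 1) → ℝ} (hx : Function.Injective x)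
    (hxT : ∏ k, (Polynomial.X - C (x k)) = C ((1 / 2 : ℝ) ^ n) * Polynomial.Chebyshev.T ℝ ((n : ℤ) + 1)) (k : Fin (n + 1)) (hk : x k ^ 2 ≠ 1) :
    ∑ j ∈ Finset.univ.erase k, (x k - x j)⁻¹ = x k / (2 * (1 - x k ^ 2)) := by
  have hT := Polynomial.Chebyshev.one_sub_X_sq_mul_derivative_derivative_T_eq_poly_in_T (R := ℝ) ((n : ℤ) + 1)
  rw [Function.iterate_succ, Function.iterate_one, Function.comp_apply] at hT
  -- multiply by the constant and rewrite in terms of `f = ∏ (X − x_k)`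
  have hf : (1 - Polynomial.X ^ 2) * derivative (derivative (∏ j, (Polynomial.X - C (x j)))) =
      Polynomial.X * derivative (∏ j, (Polynomial.X - C (x j))) - ((((n : ℤ) + 1 : ℤ) : ℝ[X]) ^ 2) * ∏ j, (Polynomial.X - C (x j)) := by
    rw [hxT]
    simp only [derivative_mul, derivative_C, zero_mul, zero_add]
    linear_combination (C ((1 / 2 : ℝ) ^ n)) * hT
  have hroot : (∏ j, (Polynomial.X - C (x j))).eval (x k) = 0 := by rw [eval_prod]; exact Finset.prod_eq_zero (Finset.mem_univ k) (by simp)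
  have hev := congrArg (eval (x k)) hf
  rw [eval_mul, eval_sub, eval_one, eval_pow, eval_X, eval_sub, eval_mul, eval_X, eval_mul, hroot, mul_zero, sub_zero, ← sum_inv_sub_nodes_eq hx k] at hev
  have hder : (derivative (∏ i, (Polynomial.X - C (x i)))).eval (x k) ≠ 0 := by
    rw [eval_derivative_prod_X_sub_C_at_node]
    exact Finset.prod_ne_zero_iff.2 fun j hj => sub_ne_zero.2 fun h => (Finset.mem_erase.1 hj).1 (hx h).symm
  have h1 : 1 - x k ^ 2 ≠ 0 := sub_ne_zero.2 (Ne.symm hk)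
  rw [eq_div_iff (mul_ne_zero two_ne_zero h1)]
  apply mul_left_cancel₀ hder
  linear_combination hev

/-- **AT THE CHEBYSHEV NODES `x_k = cos((2(n−k)+1)π∕(2n+2))` (increasing): `Σ_{j ≠ k} 1∕(x_k − x_j) = x_k ∕ (2(1 − x_k²))`.** [Stieltjes 1885; Szegő Thm 6.7.1; this file, §1162] -/
theorem chebyshev_nodes_electrostatic (n : ℕ) (k : Fin (n + 1)) :
    ∑ j ∈ Finset.univ.erase k, (cos ((2 * ((Fin.rev k : Fin (n + 1)) : ℝ) + 1) * π / (2 * ((n : ℝ) + 1))) - cos ((2 * ((Fin.rev j : Fin (n + 1)) : ℝ) + 1) * π / (2 * ((n : ℝ) + 1))))⁻¹ =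
      cos ((2 * ((Fin.rev k : Fin (n + 1)) : ℝ) + 1) * π / (2 * ((n : ℝ) + 1))) / (2 * (1 - cos ((2 * ((Fin.rev k : Fin (n + 1)) : ℝ) + 1) * π / (2 * ((n : ℝ) + 1))) ^ 2)) := by
  obtain ⟨q, hq0, hq1, hrec⟩ := recurrence_of_coefficients (fun _ => (0 : ℝ)) (fun j => if j = 1 then (1 / 2 : ℝ) else 1 / 4)
  have hprod := chebyshev_recurrence_eq_prod (a := fun _ => (0 : ℝ)) (b := fun j => if j = 1 then (1 / 2 : ℝ) else 1 / 4) hq0 hq1 hrec (fun _ => rfl) (if_pos rfl) (fun m => if_neg (by omega)) n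
  have hT := chebyshev_recurrence_eq_T (a := fun _ => (0 : ℝ)) (b := fun j => if j = 1 then (1 / 2 : ℝ) else 1 / 4) hq0 hq1 hrec (fun _ => rfl) (if_pos rfl) (fun m => if_neg (by omega)) n
  refine chebyshev_zeros_electrostatic (chebyshev_nodes_strictMono n).injective (hprod.symm.trans hT) k ?_
  -- `cos² θ ≠ 1` since `0 < θ < π`
  have hθpos : 0 < (2 * ((Fin.rev k : Fin (n + 1)) : ℝ) + 1) * π / (2 * ((n : ℝ) + 1)) := by positivity
  have hθlt : (2 * ((Fin.rev k : Fin (n + 1)) : ℝ) + 1) * π / (2 * ((n : ℝ) + 1)) < π := by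
    have hk : ((Fin.rev k : Fin (n + 1)) : ℝ) ≤ n := by exact_mod_cast Nat.lt_succ_iff.1 (Fin.rev k).is_lt
    rw [div_lt_iff₀ (by positivity)]; nlinarith [pi_pos]
  have hsin : 0 < sin ((2 * ((Fin.rev k : Fin (n + 1)) : ℝ) + 1) * π / (2 * ((n : ℝ) + 1))) := sin_pos_of_pos_of_lt_pi hθpos hθlt
  intro h
  have := sin_sq_add_cos_sq ((2 * ((Fin.rev k : Fin (n + 1)) : ℝ) + 1) * π / (2 * ((n : ℝ) + 1)))
  nlinarith

end Summit.Ventures.HSemireg.Wedge.HankelOuter
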